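import Summits.HodgeConjecture.HodgeConjecture.Theorems.F0P3cStCharTSDGFieldTwo       -- ★ p851405 (this seat) «DG-FIELD★» at `N = 2`: `exists_unit_rel_iff_isUnit_discr_two` (the HC antecedent ↔ unit discriminant); brings ★ DGField §0
import Literature.NumberTheory.Rogawski1990.Ch12Sec7CharacterInputs                    -- ★ p850727 the NAMED FACT (HC-B) `normalizedCharacter_locallyBounded` [HarishChandra1999AdmissibleDistributions Thm. 16.3]
import Literature.NumberTheory.Rogawski1990.Ch12Sec5Defs                              -- ★ TR dictionary: `EllipticData` (fields `DH`, `charH`, `cartanH`, `sqPacketsH`; `packetCharH`)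
import HarnessLib

/-!
# F0 · P3c · line LH6 «StCharTS» — «HCB-H★» (datum road, (B) «H-FIELDS» downstream): HARISH-CHANDRA'S BOUND ON THE `H`-SIDE — «`|D_H(s)·χ_ρ(s)| ≤ B_C` on every compact
# `C ⊆ H = U(Φ₂)(L⁺_v) × U(Φ₁)(L⁺_v)`, `ρ = {St_H(ξ_v)}`» — the hypothesis `hHBH` of ★ S12a `F0P3cStCharTSDefHGlue` (DEF-H) and of ★ S13a `F0P3cStCharTSU2OfUpDom` ∕ S13c
# (U2, HCB-up, UP-DOM) as a THEOREM of the named fact (HC-B) at `N = 2` [Rogawski1990, §1.6 p. 6 («due to Harish-Chandra»); §12.5 p. 184; §12.7 L. 12.7.2 (proof) p. 193]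

Cell `pub/hodgecm-mathlib`, crux H413 = `stmt-HodgeConjecture-24833` (lane `--supports … --as helper`), route HCCMUnconditional; seat F0P3-p02 (g20); datum road of the (S-𝔇)
organ `stub_EllipticPackage` (`Cruxes/H413/Lines/F0_P3c_StCharTSPaydown.lean`), map owner LH6-p01 (g4); downstream of F0P2-p01 (g21)'s (B) «H-FIELDS» pins (P4) «`χ_{St_H(ξ_v)} = Θ₂ ⊠ χ₁`»
(★ `HLengthTwoLabels.exists_eq_boxChar` + ★ S1 at `N = 2`) and (P6) «`D_H := D_{U(Φ₂)} ∘ pr₁`» (★ `exists_DG_field_two`).  THEOREMS ONLY (no definition ∕ instance ∕ notation ∕ named fact ∕ `sorry`);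
★-only imports; HYPOTHESIS FORM (road rule §2.1): the pins enter as field equations on an abstract datum, the `U(Φ₂)`-character as an HC character function, the second factor as
ANY topological space `G₁` with a continuous `χ₁`.
HONEST LABEL: HC_CM is proved only modulo the 7 printed citations (2 remaining named inputs: hLiu418 = `stmt-HodgeConjecture-24832`, h413 = `stmt-HodgeConjecture-24833`)
until rung 0 closes; this file closes no organ — it makes the `H`-side bound hypotheses of three ★ slices consequences of the named fact (HC-B) ★ `normalizedCharacter_locallyBounded`
(already a conjunct of the organ since ED. 14), count-neutral.

THE MATHEMATICS.  [Rogawski1990, §1.6 p. 6]: the character of an irreducible admissible representation of `H` is a locally integrable function, and (Harish-Chandra, [H₁] Thm. 16.3)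
`|D_H|^{1∕2}·χ` is locally bounded.  For `H = U(Φ₂)(L⁺_v) × U(Φ₁)(L⁺_v)` and `ρ = {St_H(ξ_v)}`: `χ_ρ(γ₂, γ₁) = Θ₂(γ₂)·χ₁(γ₁)` with `Θ₂` the Harish-Chandra character function of the
`U(Φ₂)`-factor `St₂` and `χ₁ = ψ_v ∘ det₁` a continuous character of the (compact) `U(Φ₁)` factor; `D_H(γ₂, γ₁) = D_{U(Φ₂)}(γ₂)` (the `U(1)` factor has no roots) `= √√‖u₂‖` when
`u₂·det(γ₂) = discr(charpoly γ₂)` and `= 0` at `U(2)`-singular `γ₂` [§4.9 pp. 54–55].  On a compact `C ⊆ H`: (HC-B) at `N = 2` on the compact `pr₁(C)` gives `√√‖u₂‖·|Θ₂(γ₂)| ≤ B₂`,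
`χ₁` is bounded by `M` on the compact `pr₂(C)`, hence `|D_H(s)·χ_ρ(s)| ≤ max B₂ 0 · M` for every `s ∈ C` (singular `γ₂`: the left side is `0`).
* §1 `exists_bound_DH_mul_of_boxChar` — the bound on any compact `C ⊆ U(J)(L⁺_v) × G₁` (generic `2 × 2` Hermitian non-degenerate `J`, generic second factor `G₁`);
* §2 (GENERIC carriers) `hHBH_of_compactBound`, `hHBH_cartanH_of_compactBound` — the S13a∕S13c text («`∀ ρ ∈ sqPacketsH, ∀ C` compact, `∃ B, ∀ s ∈ C, P s → …`», any `P`) and the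
  S12a text («`∀ ρ ∈ sqPacketsH, ∀ T ∈ cartanH, ∀ C` compact `⊆ T`, `∃ B, ∀ γ ∈ C, …`») from ONE compact-set bound for `𝔇.charH πSt` and the field equation `hSq : sqPacketsH = {{πSt}}`
  (the shape (B) «H-FIELDS» can export as its (HCB-H) clause);
* §3 at a datum `𝔇 : EllipticData G (U(J)(L⁺_v) × G₁)` with the field equations `hDHf : 𝔇.DH = DG₂ ∘ pr₁`, `hcharSt : 𝔇.charH πSt = Θ₂ ⊠ χ₁`: `compactBound_charH_of_boxChar` (the
  compact-set bound from §1), `hHBH_of_boxChar`, `hHBH_cartanH_of_boxChar` (the two texts, under `hSq`).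

## References
* [Rogawski1990] J. D. Rogawski, *Automorphic Representations of Unitary Groups in Three Variables*, Ann. of Math. Stud. 123 (1990): §1.6 p. 6 ([H₁] on `H`); §4.9 pp. 54–55 (`D_H`);
  §12.5 p. 184 (`⟨ , ⟩_{H,e}`); §12.7 Lemma 12.7.2 (proof) p. 193 («bounded elliptic norm»).
* [HarishChandra1999AdmissibleDistributions] Harish-Chandra (notes by S. DeBacker, P. J. Sally), *Admissible invariant distributions on reductive p-adic groups*, AMS ULS 16 (1999):
  Part III §16 Thm. 16.3; §17.
-/

set_option autoImplicit false
-- the mandated namespace has the single-problem summit's repeated segment (`HodgeConjecture.HodgeConjecture`)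
set_option linter.dupNamespace false

noncomputable section

open MeasureTheory Filter Topology
open NumberField IsDedekindDomain
open scoped NNReal Matrix MatrixGroups
open Literature.NumberTheory.Automorphic Literature.NumberTheory.Automorphic.UnitaryGroup
open Literature.NumberTheory.Rogawski1990 Literature.NumberTheory.Rogawski1990.Ch12Sec5

namespace Summit.HodgeConjecture.HodgeConjecture.Cruxes.H413.F0P3cStCharTSHcbH

variable (L : Type) [Field L] [NumberField L] [IsCMField L] (v : HeightOneSpectrum (𝓞 ↥(maximalRealSubfield L)))

/-! ## §1 The bound on a compact subset of `U(J)(L⁺_v) × G₁` from (HC-B) at `N = 2` -/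

/-- **«HCB-H★» — `|D_H(s)·(Θ₂ ⊠ χ₁)(s)| ≤ B` on every compact `C ⊆ U(J)(L⁺_v) × G₁`.**  `J` a non-degenerate Hermitian `2 × 2` form over the CM field `L`, `v` a finite place of `L⁺`,
`G₂ = U(J)(L⁺_v)` with a Haar measure `μ₂`; `Θ₂` a Harish-Chandra character function of a class `σ₂` of `G₂` (locally integrable, locally constant at the regular points, representing
`Tr σ₂` — the antecedents of ★ `normalizedCharacter_locallyBounded`); `G₁` any topological space with a continuous `χ₁ : G₁ → ℂ`; `DG₂` any function with the two letters of ★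
`exists_DG_field_two` (`= 0` at a non-unit discriminant, `= √√‖u‖` at the HC antecedent `u·det(γ)^(2−1) = discr(charpoly γ)`); `D_H = DG₂ ∘ pr₁` and `Θ = Θ₂ ⊠ χ₁` as equations.
THEN, GIVEN (HC-B) `hHC`, every compact `C ⊆ G₂ × G₁` carries a bound `‖D_H(s)·Θ(s)‖ ≤ B`. [cite: Rogawski1990, §1.6 p. 6; §4.9 pp. 54–55; §12.7 Lemma 12.7.2 (proof) p. 193]
[cite: HarishChandra1999AdmissibleDistributions, Part III §16 Thm. 16.3] -/
theorem exists_bound_DH_mul_of_boxChar (hHC : normalizedCharacter_locallyBounded)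
    (J : Matrix (Fin 2) (Fin 2) L) (hJ : (J.map (cmConjRingHom L))ᵀ = J) (hJd : J.det ≠ 0)
    [MeasurableSpace ((UnitaryGroup.cmDatum L 2 J).Local v)] [BorelSpace ((UnitaryGroup.cmDatum L 2 J).Local v)]
    (μ₂ : Measure ((UnitaryGroup.cmDatum L 2 J).Local v)) [μ₂.IsHaarMeasure]
    (σ₂ : IrrClass ((UnitaryGroup.cmDatum L 2 J).Local v)) (Θ₂ : (UnitaryGroup.cmDatum L 2 J).Local v → ℂ)
    (hli : LocallyIntegrable Θ₂ μ₂)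
    (hlc : ∀ x : (UnitaryGroup.cmDatum L 2 J).Local v, IsRegularElt (x.val : GL (Fin 2) (UnitaryGroup.LocalRing L v)) → ∀ᶠ y in 𝓝 x, Θ₂ y = Θ₂ x)
    (htr : ∀ φ : (UnitaryGroup.cmDatum L 2 J).Local v → ℂ, IsLocSmooth φ → σ₂.smoothTrace μ₂ φ = ∫ x, φ x * Θ₂ x ∂μ₂)
    {G₁ : Type} [TopologicalSpace G₁] (χ₁ : G₁ → ℂ) (hχ₁ : Continuous χ₁)
    (DG₂ : (UnitaryGroup.cmDatum L 2 J).Local v → ℝ)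
    (hDG₂0 : ∀ γ : (UnitaryGroup.cmDatum L 2 J).Local v, ¬ IsUnit ((γ.val.val.charpoly).discr) → DG₂ γ = 0)
    (hDG₂rel : ∀ (γ : (UnitaryGroup.cmDatum L 2 J).Local v) (u : (UnitaryGroup.LocalRing L v)ˣ),
      (u : UnitaryGroup.LocalRing L v) * (γ.val.val.det) ^ (2 - 1) = (γ.val.val.charpoly).discr →
        DG₂ γ = ((NNReal.sqrt (NNReal.sqrt (unitModulusChar (UnitaryGroup.LocalRing L v) u)) : ℝ≥0) : ℝ))
    (DH : (UnitaryGroup.cmDatum L 2 J).Local v × G₁ → ℝ) (hDH : ∀ h, DH h = DG₂ h.1)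
    (Θ : (UnitaryGroup.cmDatum L 2 J).Local v × G₁ → ℂ) (hΘ : ∀ h, Θ h = Θ₂ h.1 * χ₁ h.2)
    (C : Set ((UnitaryGroup.cmDatum L 2 J).Local v × G₁)) (hC : IsCompact C) :
    ∃ B : ℝ, ∀ s ∈ C, ‖(DH s : ℂ) * Θ s‖ ≤ B := by
  -- (HC-B) at `N = 2` on the compact first projection
  obtain ⟨B₂, hB₂⟩ := hHC L 2 J hJ hJd v μ₂ σ₂ Θ₂ hli hlc htr (Prod.fst '' C) (hC.image continuous_fst)
  -- `χ₁` is bounded on the compact second projection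
  obtain ⟨M, hM⟩ := (hC.image continuous_snd).exists_bound_of_continuousOn (f := χ₁) hχ₁.continuousOn
  refine ⟨max B₂ 0 * max M 0, fun s hs => ?_⟩
  have h1 : s.1 ∈ Prod.fst '' C := Set.mem_image_of_mem _ hs
  have h2 : ‖χ₁ s.2‖ ≤ max M 0 := (hM s.2 (Set.mem_image_of_mem _ hs)).trans (le_max_left _ _)
  rw [hDH s, hΘ s, ← mul_assoc, norm_mul]
  refine mul_le_mul ?_ h2 (norm_nonneg _) (le_max_of_le_right le_rfl)
  -- the `U(J)` factor: regular (HC antecedent inhabited) or singular (`DG₂ = 0`)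
  by_cases hreg : IsUnit ((s.1.val.val.charpoly).discr)
  · obtain ⟨u, hu⟩ := (F0P3cStCharTSDGFieldTwo.exists_unit_rel_iff_isUnit_discr_two L v J s.1).2 hreg
    rw [norm_mul, Complex.norm_real, Real.norm_eq_abs, hDG₂rel s.1 u hu, abs_of_nonneg (NNReal.coe_nonneg _)]
    exact (hB₂ s.1 h1 u hu).trans (le_max_left _ _)
  · rw [hDG₂0 s.1 hreg, Complex.ofReal_zero, zero_mul, norm_zero]
    exact le_max_right _ _

/-! ## §2 At a datum (GENERIC carriers): the `hHBH` texts of ★ S13a∕S13c and ★ S12a from ONE compact-set bound for `χ_{St_H}` and `hSq` -/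

section Generic

variable {G H : Type} [Group G] [TopologicalSpace G] [IsTopologicalGroup G] [MeasurableSpace G]
  [∀ γ : G, MeasurableSpace (G ⧸ Subgroup.centralizer ({γ} : Set G))] [MeasurableSpace (G ⧸ Subgroup.center G)]
  [Group H] [TopologicalSpace H] [IsTopologicalGroup H] [MeasurableSpace H]

/-- **S13a∕S13c's `hHBH` text** (any predicate `P`; the antecedent `P s` is not used) from the compact-set bound «`∀ C ⊆ H` compact, `∃ B, ∀ s ∈ C, ‖D_H(s)·χ_{πSt}(s)‖ ≤ B`» (§1 ∕ §3, or the
(HCB-H) clause exported by (B) «H-FIELDS») and the field equation `hSq : sqPacketsH = {{πSt}}` (map owner 2026-09-02T12:00:15Z (3′), 12:26:12Z «=»).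
[cite: Rogawski1990, §1.6 p. 6; §12.7 Lemma 12.7.2 (proof) p. 193] [cite: HarishChandra1999AdmissibleDistributions, Part III §16 Thm. 16.3] -/
theorem hHBH_of_compactBound (𝔇 : EllipticData G H) (πSt : IrrClass H)
    (hSq : 𝔇.sqPacketsH = {({πSt} : Finset (IrrClass H))})
    (hB : ∀ C : Set H, IsCompact C → ∃ B : ℝ, ∀ s ∈ C, ‖(𝔇.DH s : ℂ) * 𝔇.charH πSt s‖ ≤ B)
    (P : H → Prop) :
    ∀ ρ ∈ 𝔇.sqPacketsH, ∀ C : Set H, IsCompact C → ∃ B : ℝ, ∀ s ∈ C, P s → ‖(𝔇.DH s : ℂ) * 𝔇.packetCharH ρ s‖ ≤ B := by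
  intro ρ hρ C hC
  rw [hSq, Set.mem_singleton_iff] at hρ
  subst hρ
  obtain ⟨B, hB'⟩ := hB C hC
  refine ⟨B, fun s hs _ => ?_⟩
  rw [EllipticData.packetCharH, Finset.sum_singleton]
  exact hB' s hs

/-- **S12a's `hHBH` text** (over the elliptic `H`-representatives `T ∈ cartanH`, compact `C ⊆ T`) from the same compact-set bound and `hSq`. [cite: Rogawski1990, §12.5 p. 184; §1.6 p. 6]
[cite: HarishChandra1999AdmissibleDistributions, Part III §16 Thm. 16.3] -/
theorem hHBH_cartanH_of_compactBound (𝔇 : EllipticData G H) (πSt : IrrClass H)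
    (hSq : 𝔇.sqPacketsH = {({πSt} : Finset (IrrClass H))})
    (hB : ∀ C : Set H, IsCompact C → ∃ B : ℝ, ∀ s ∈ C, ‖(𝔇.DH s : ℂ) * 𝔇.charH πSt s‖ ≤ B) :
    ∀ ρ ∈ 𝔇.sqPacketsH, ∀ T ∈ 𝔇.cartanH, ∀ C : Set H, IsCompact C → C ⊆ (T : Set H) →
      ∃ B : ℝ, ∀ γ ∈ C, ‖(𝔇.DH γ : ℂ) * 𝔇.packetCharH ρ γ‖ ≤ B := by
  intro ρ hρ T _ C hC _
  obtain ⟨B, hB'⟩ := hHBH_of_compactBound 𝔇 πSt hSq hB (fun _ => True) ρ hρ C hC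
  exact ⟨B, fun γ hγ => hB' γ hγ trivial⟩

end Generic

/-! ## §3 The compact-set bound at a datum on `U(J)(L⁺_v) × G₁` with the (B) «H-FIELDS» field equations `D_H = DG₂ ∘ pr₁`, `χ_{St_H} = Θ₂ ⊠ χ₁` — and the two `hHBH` texts from them -/

section Datum

variable {G : Type} [Group G] [TopologicalSpace G] [IsTopologicalGroup G] [MeasurableSpace G]
  [∀ γ : G, MeasurableSpace (G ⧸ Subgroup.centralizer ({γ} : Set G))] [MeasurableSpace (G ⧸ Subgroup.center G)]

/-- **The compact-set bound for `𝔇.charH πSt` on every compact `C ⊆ H`** at a datum `𝔇 : EllipticData G (U(J)(L⁺_v) × G₁)` whose `DH` and `charH πSt` satisfy the (B) «H-FIELDS»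
field equations `DH = DG₂ ∘ pr₁` (`DG₂` with the two letters of ★ `exists_DG_field_two`) and `charH πSt = Θ₂ ⊠ χ₁` (§1).  This is the (HCB-H) clause the `H`-fields witness can export.
[cite: Rogawski1990, §1.6 p. 6; §12.5 p. 184] [cite: HarishChandra1999AdmissibleDistributions, Part III §16 Thm. 16.3] -/
theorem compactBound_charH_of_boxChar (hHC : normalizedCharacter_locallyBounded)
    (J : Matrix (Fin 2) (Fin 2) L) (hJ : (J.map (cmConjRingHom L))ᵀ = J) (hJd : J.det ≠ 0)
    [MeasurableSpace ((UnitaryGroup.cmDatum L 2 J).Local v)] [BorelSpace ((UnitaryGroup.cmDatum L 2 J).Local v)]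
    (μ₂ : Measure ((UnitaryGroup.cmDatum L 2 J).Local v)) [μ₂.IsHaarMeasure]
    (σ₂ : IrrClass ((UnitaryGroup.cmDatum L 2 J).Local v)) (Θ₂ : (UnitaryGroup.cmDatum L 2 J).Local v → ℂ)
    (hli : LocallyIntegrable Θ₂ μ₂)
    (hlc : ∀ x : (UnitaryGroup.cmDatum L 2 J).Local v, IsRegularElt (x.val : GL (Fin 2) (UnitaryGroup.LocalRing L v)) → ∀ᶠ y in 𝓝 x, Θ₂ y = Θ₂ x)
    (htr : ∀ φ : (UnitaryGroup.cmDatum L 2 J).Local v → ℂ, IsLocSmooth φ → σ₂.smoothTrace μ₂ φ = ∫ x, φ x * Θ₂ x ∂μ₂)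
    {G₁ : Type} [Group G₁] [TopologicalSpace G₁] [IsTopologicalGroup G₁] [MeasurableSpace (((UnitaryGroup.cmDatum L 2 J).Local v) × G₁)]
    (χ₁ : G₁ → ℂ) (hχ₁ : Continuous χ₁)
    (DG₂ : (UnitaryGroup.cmDatum L 2 J).Local v → ℝ)
    (hDG₂0 : ∀ γ : (UnitaryGroup.cmDatum L 2 J).Local v, ¬ IsUnit ((γ.val.val.charpoly).discr) → DG₂ γ = 0)
    (hDG₂rel : ∀ (γ : (UnitaryGroup.cmDatum L 2 J).Local v) (u : (UnitaryGroup.LocalRing L v)ˣ),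
      (u : UnitaryGroup.LocalRing L v) * (γ.val.val.det) ^ (2 - 1) = (γ.val.val.charpoly).discr →
        DG₂ γ = ((NNReal.sqrt (NNReal.sqrt (unitModulusChar (UnitaryGroup.LocalRing L v) u)) : ℝ≥0) : ℝ))
    (𝔇 : EllipticData G (((UnitaryGroup.cmDatum L 2 J).Local v) × G₁)) (πSt : IrrClass (((UnitaryGroup.cmDatum L 2 J).Local v) × G₁))
    (hDHf : ∀ h, 𝔇.DH h = DG₂ h.1) (hcharSt : ∀ h, 𝔇.charH πSt h = Θ₂ h.1 * χ₁ h.2) :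
    ∀ C : Set (((UnitaryGroup.cmDatum L 2 J).Local v) × G₁), IsCompact C → ∃ B : ℝ, ∀ s ∈ C, ‖(𝔇.DH s : ℂ) * 𝔇.charH πSt s‖ ≤ B :=
  fun C hC => exists_bound_DH_mul_of_boxChar L v hHC J hJ hJd μ₂ σ₂ Θ₂ hli hlc htr χ₁ hχ₁ DG₂ hDG₂0 hDG₂rel 𝔇.DH hDHf (𝔇.charH πSt) hcharSt C hC

/-- **S13a∕S13c's `hHBH` as a theorem of the field equations** (+ `hSq`): §3's bound through §2. [cite: Rogawski1990, §1.6 p. 6; §12.7 Lemma 12.7.2 (proof) p. 193]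
[cite: HarishChandra1999AdmissibleDistributions, Part III §16 Thm. 16.3] -/
theorem hHBH_of_boxChar (hHC : normalizedCharacter_locallyBounded)
    (J : Matrix (Fin 2) (Fin 2) L) (hJ : (J.map (cmConjRingHom L))ᵀ = J) (hJd : J.det ≠ 0)
    [MeasurableSpace ((UnitaryGroup.cmDatum L 2 J).Local v)] [BorelSpace ((UnitaryGroup.cmDatum L 2 J).Local v)]
    (μ₂ : Measure ((UnitaryGroup.cmDatum L 2 J).Local v)) [μ₂.IsHaarMeasure]
    (σ₂ : IrrClass ((UnitaryGroup.cmDatum L 2 J).Local v)) (Θ₂ : (UnitaryGroup.cmDatum L 2 J).Local v → ℂ)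
    (hli : LocallyIntegrable Θ₂ μ₂)
    (hlc : ∀ x : (UnitaryGroup.cmDatum L 2 J).Local v, IsRegularElt (x.val : GL (Fin 2) (UnitaryGroup.LocalRing L v)) → ∀ᶠ y in 𝓝 x, Θ₂ y = Θ₂ x)
    (htr : ∀ φ : (UnitaryGroup.cmDatum L 2 J).Local v → ℂ, IsLocSmooth φ → σ₂.smoothTrace μ₂ φ = ∫ x, φ x * Θ₂ x ∂μ₂)
    {G₁ : Type} [Group G₁] [TopologicalSpace G₁] [IsTopologicalGroup G₁] [MeasurableSpace (((UnitaryGroup.cmDatum L 2 J).Local v) × G₁)]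
    (χ₁ : G₁ → ℂ) (hχ₁ : Continuous χ₁)
    (DG₂ : (UnitaryGroup.cmDatum L 2 J).Local v → ℝ)
    (hDG₂0 : ∀ γ : (UnitaryGroup.cmDatum L 2 J).Local v, ¬ IsUnit ((γ.val.val.charpoly).discr) → DG₂ γ = 0)
    (hDG₂rel : ∀ (γ : (UnitaryGroup.cmDatum L 2 J).Local v) (u : (UnitaryGroup.LocalRing L v)ˣ),
      (u : UnitaryGroup.LocalRing L v) * (γ.val.val.det) ^ (2 - 1) = (γ.val.val.charpoly).discr →
        DG₂ γ = ((NNReal.sqrt (NNReal.sqrt (unitModulusChar (UnitaryGroup.LocalRing L v) u)) : ℝ≥0) : ℝ))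
    (𝔇 : EllipticData G (((UnitaryGroup.cmDatum L 2 J).Local v) × G₁)) (πSt : IrrClass (((UnitaryGroup.cmDatum L 2 J).Local v) × G₁))
    (hDHf : ∀ h, 𝔇.DH h = DG₂ h.1) (hcharSt : ∀ h, 𝔇.charH πSt h = Θ₂ h.1 * χ₁ h.2)
    (hSq : 𝔇.sqPacketsH = {({πSt} : Finset (IrrClass (((UnitaryGroup.cmDatum L 2 J).Local v) × G₁)))})
    (P : ((UnitaryGroup.cmDatum L 2 J).Local v) × G₁ → Prop) :
    ∀ ρ ∈ 𝔇.sqPacketsH, ∀ C : Set (((UnitaryGroup.cmDatum L 2 J).Local v) × G₁), IsCompact C →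
      ∃ B : ℝ, ∀ s ∈ C, P s → ‖(𝔇.DH s : ℂ) * 𝔇.packetCharH ρ s‖ ≤ B :=
  hHBH_of_compactBound 𝔇 πSt hSq
    (compactBound_charH_of_boxChar L v hHC J hJ hJd μ₂ σ₂ Θ₂ hli hlc htr χ₁ hχ₁ DG₂ hDG₂0 hDG₂rel 𝔇 πSt hDHf hcharSt) P

/-- **S12a's `hHBH` as a theorem of the field equations** (+ `hSq`). [cite: Rogawski1990, §12.5 p. 184; §1.6 p. 6] [cite: HarishChandra1999AdmissibleDistributions, Part III §16 Thm. 16.3] -/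
theorem hHBH_cartanH_of_boxChar (hHC : normalizedCharacter_locallyBounded)
    (J : Matrix (Fin 2) (Fin 2) L) (hJ : (J.map (cmConjRingHom L))ᵀ = J) (hJd : J.det ≠ 0)
    [MeasurableSpace ((UnitaryGroup.cmDatum L 2 J).Local v)] [BorelSpace ((UnitaryGroup.cmDatum L 2 J).Local v)]
    (μ₂ : Measure ((UnitaryGroup.cmDatum L 2 J).Local v)) [μ₂.IsHaarMeasure]
    (σ₂ : IrrClass ((UnitaryGroup.cmDatum L 2 J).Local v)) (Θ₂ : (UnitaryGroup.cmDatum L 2 J).Local v → ℂ)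
    (hli : LocallyIntegrable Θ₂ μ₂)
    (hlc : ∀ x : (UnitaryGroup.cmDatum L 2 J).Local v, IsRegularElt (x.val : GL (Fin 2) (UnitaryGroup.LocalRing L v)) → ∀ᶠ y in 𝓝 x, Θ₂ y = Θ₂ x)
    (htr : ∀ φ : (UnitaryGroup.cmDatum L 2 J).Local v → ℂ, IsLocSmooth φ → σ₂.smoothTrace μ₂ φ = ∫ x, φ x * Θ₂ x ∂μ₂)
    {G₁ : Type} [Group G₁] [TopologicalSpace G₁] [IsTopologicalGroup G₁] [MeasurableSpace (((UnitaryGroup.cmDatum L 2 J).Local v) × G₁)]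
    (χ₁ : G₁ → ℂ) (hχ₁ : Continuous χ₁)
    (DG₂ : (UnitaryGroup.cmDatum L 2 J).Local v → ℝ)
    (hDG₂0 : ∀ γ : (UnitaryGroup.cmDatum L 2 J).Local v, ¬ IsUnit ((γ.val.val.charpoly).discr) → DG₂ γ = 0)
    (hDG₂rel : ∀ (γ : (UnitaryGroup.cmDatum L 2 J).Local v) (u : (UnitaryGroup.LocalRing L v)ˣ),
      (u : UnitaryGroup.LocalRing L v) * (γ.val.val.det) ^ (2 - 1) = (γ.val.val.charpoly).discr →
        DG₂ γ = ((NNReal.sqrt (NNReal.sqrt (unitModulusChar (UnitaryGroup.LocalRing L v) u)) : ℝ≥0) : ℝ))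
    (𝔇 : EllipticData G (((UnitaryGroup.cmDatum L 2 J).Local v) × G₁)) (πSt : IrrClass (((UnitaryGroup.cmDatum L 2 J).Local v) × G₁))
    (hDHf : ∀ h, 𝔇.DH h = DG₂ h.1) (hcharSt : ∀ h, 𝔇.charH πSt h = Θ₂ h.1 * χ₁ h.2)
    (hSq : 𝔇.sqPacketsH = {({πSt} : Finset (IrrClass (((UnitaryGroup.cmDatum L 2 J).Local v) × G₁)))}) :
    ∀ ρ ∈ 𝔇.sqPacketsH, ∀ T ∈ 𝔇.cartanH, ∀ C : Set (((UnitaryGroup.cmDatum L 2 J).Local v) × G₁), IsCompact C → C ⊆ (T : Set (((UnitaryGroup.cmDatum L 2 J).Local v) × G₁)) →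
      ∃ B : ℝ, ∀ γ ∈ C, ‖(𝔇.DH γ : ℂ) * 𝔇.packetCharH ρ γ‖ ≤ B :=
  hHBH_cartanH_of_compactBound 𝔇 πSt hSq
    (compactBound_charH_of_boxChar L v hHC J hJ hJd μ₂ σ₂ Θ₂ hli hlc htr χ₁ hχ₁ DG₂ hDG₂0 hDG₂rel 𝔇 πSt hDHf hcharSt)

end Datum

end Summit.HodgeConjecture.HodgeConjecture.Cruxes.H413.F0P3cStCharTSHcbH

end
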